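import Mathlib.LinearAlgebra.SymplecticGroup
import Mathlib.Data.Matrix.Basis
import Mathlib.Algebra.QuadraticAlgebra.Basic
import Mathlib.Tactic
import HarnessLib

/-!
# Orlov's `U(Eⁿ × Êⁿ)` in the block model, II: `f̃` is Mathlib's symplectic inverse, Example 4.15 as
# membership in `Matrix.symplecticGroup`; the translations `T_S` and `J`; `iJ` hermitian over `ℤ[i]`;
# a non-`μ · Sp` witness for every quadratic order and every `n ≥ 2`

Venture cell `pub-hsemireg` (Lean root `Summits/Ventures/HSemireg/`), literature seat
`lit-w-polishchuk-orlov` (g8, 2026-08-24). Sequel of `OrlovIsometryGroupCMBlockModel.lean` (g7; not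
imported — every statement below is proved from Mathlib directly), whose `orlovIsometricBlock_iff` reads
Orlov's isometry condition `f̃ f = 1` ([Orlov2002DerivedAbelian] Def. 2.17, arXiv alg-geom/9712017v4
p. 14 L16–36; Izv. Math. 66:3 (2002) p. 583) for `A = Eⁿ` in the `2n × 2n` block model over `R = End(E)`
as `f† J f = J` (`f† := σ(f)ᵀ`, `σ` = the Rosati involution of `E`; `J := (0 1; −1 0)` in `n × n` blocks).

PRINTED (quoted; locator sheet `widen/LIT-W/LITW-POLISHCHUK-ORLOV-LOCATOR-SHEET.md` §D1/§D7, TABLE rows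
M-PO1/M-PO6): before Def. 2.17 (p. 14) a morphism `f : A × Â → B × B̂` is a matrix `f = (α β; γ δ)` and
`f̃ := (δ̂ −β̂; −γ̂ α̂)`; Def. 2.17: `f` is isometric iff `f̃ = f⁻¹`; Example 4.15 (arXiv v4 p. 24 L3–4;
Izv. p. 593): "Consider the example `A = Eⁿ`, where `E` is an elliptic curve without complex
multiplication. Then the group `U(A × Â)` is isomorphic to `Sp_{2n}(ℤ)`." The cell's S4 corner 2 uses
exactly this (`s4push/search-2/g6/SHADOW-TEST-search-2-g6.md` §2 (A): "`U(A × Â) = {f ∈ GL₂(M₆(ℤ)) :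
f⁻¹ = [[dᵀ, −bᵀ],[−cᵀ, aᵀ]]} = Sp₁₂(ℤ)`", `E` generic, with the generators "`⊗L_S` (`S ∈ Sym₆(ℤ) =
NS(A)`)" and "`[[1,S],[0,1]], [[0,−1],[1,0]]`").

## Results (PROVED: no named fact, no `sorry`; imports Mathlib + HarnessLib only)

* `orlovTildeBlock_eq_symplecticInv`: in the block model with hat = Rosati transpose,
  `f̃ = (d† −b†; −c† a†) = (−J') · f† · J'` where `J' := Matrix.J n R = (0 −1; 1 0)` is MATHLIB's matrix
  (`= −J = Jᵀ` for the cell's `J = (0 1; −1 0)`, `blockJ_eq_neg_J`) — i.e. for `σ = id` Orlov's `f̃` IS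
  Mathlib's symplectic inverse `SymplecticGroup.coe_inv : ↑A⁻¹ = (−J) · Aᵀ · J`.
* `orlovIsometricBlock_id_iff_mem_symplecticGroup`: for `σ = id` (the reading of `End(E) = ℤ`, Rosati =
  transpose) `f̃ · f = 1 ⟺ f ∈ Matrix.symplecticGroup n R` — Example 4.15 in kernel form, for every
  commutative ring `R` and finite index type `n` (the modelling step `End(Eⁿ × Êⁿ) = M₂(Mₙ(ℤ))`,
  hat = transpose, is assumed, NOT proved); `orlovIsometricBlock_iff_mem_symplecticGroup_of_map_eq`: the
  same for any `σ` on `σ`-fixed matrices (the subgroup `Sp_{2n}(ℤ) ⊂ U` at a CM point).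
* `orlovIsometricBlock_transvection_iff`: `T_S = (1 S; 0 1)` satisfies `T_S† J T_S = J` IFF `S† = S`; for
  `σ = id`: iff `S` is symmetric — the `⊗L_S`, `S ∈ NS(Eⁿ) ≅ Symₙ(ℤ)`, of the S4 file; for a CM order
  `End(E) = O` the admissible `S` are the `σ`-hermitian matrices (the model of `NS(E_Kⁿ)`). DERIVED HERE.
* `orlovIsometricBlock_blockJ`: `J` itself satisfies `J† J J = J` for every `σ`. DERIVED HERE.
* `orlovIsometricBlock_iff_smul_unit` + `gaussInt_omega_smul_blockJ_conjTranspose`: `f† J f = J ⟺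
  f† (zJ) f = zJ` for a unit `z`; over `ℤ[i]` the matrix `iJ` is HERMITIAN (`(iJ)† = iJ`), so in the block
  model `U(E_iⁿ × Ê_iⁿ)` is the unitary group of the hermitian `ℤ[i]`-lattice `(ℤ[i]^{2n}, iJ)` of signature
  `(n, n)` — the object the cell's S4 corner 2 calls «`U(6,6)(ℤ[i])`» (`SHADOW-TEST-search-2-g6.md` (u1),
  `n = 6`). DERIVED HERE; Orlov prints no such statement.
* `quadraticOrder_blockDiag_isometric` + `quadraticOrder_blockDiag_ne_smul_intCast`: for EVERY quadratic
  order `ℤ[ω] = QuadraticAlgebra ℤ a b` (`ω² = a + bω`, `σ = star : ω ↦ b − ω`), every finite `n` and every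
  pair of indices `i ≠ j`, `F = diag(1 + ω E_{ij}, 1 − σ(ω) E_{ji})` satisfies `F† J F = J` and is not
  `ζ · H` for any `ζ ∈ ℤ[ω]` and any integer matrix `H`. Read with `σ` = complex conjugation of an
  imaginary-quadratic order `End(E) = ℤ[ω]` (the CM case): for `n ≥ 2` the integral group `U(Eⁿ × Êⁿ)`
  is STRICTLY larger than `μ_K · Sp_{2n}(ℤ)` for every CM elliptic curve, not only `E_i` (g7's witness
  `gaussInt_blockDiag_*` is `ℤ[i]`, `n = 2`). DERIVED HERE; Orlov prints no statement about the CM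
  integral group (TABLE M-PO6 «print does NOT give»; `n = 1`: `U(E × Ê) = μ_K · SL₂(ℤ)`,
  `OrlovIsometryGroupCM*.lean`).

HONEST FRAMING: elementary identities between block matrices over a commutative ring with an endomorphism
`σ`; DERIVED HERE, not printed statements (rule R3: never a quotation); nothing here constructs a derived
category or an abelian variety, decides any orbit, or says that HC, HC_CM or HC_AV holds.
-/

namespace Summit.Ventures.HSemireg

open Matrix

section Symplectic

variable {R : Type*} [CommRing R] {n : Type*} [Fintype n] [DecidableEq n]

omit [Fintype n] in
/-- The cell's `J = (0 1; −1 0)` is the negative (equivalently, by `Matrix.J_transpose`, the transpose) of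
Mathlib's `Matrix.J n R = (0 −1; 1 0)`. [folklore] -/
theorem blockJ_eq_neg_J : (fromBlocks 0 1 (-1) 0 : Matrix (n ⊕ n) (n ⊕ n) R) = -Matrix.J n R := by
  rw [Matrix.J, fromBlocks_neg, neg_zero, neg_neg]

/-- **`f̃ = (−J) f† J` (Mathlib's symplectic-inverse shape).** Orlov's `f̃ = (δ̂ −β̂; −γ̂ α̂)`
([cite: Orlov2002DerivedAbelian, Def 2.17], read in the block model for `A = Eⁿ` with hat = Rosati
transpose `x ↦ σ(x)ᵀ`) equals `(−J') · σ(f)ᵀ · J'` for Mathlib's `J' = Matrix.J n R`; for `σ = id` this is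
the formula `SymplecticGroup.coe_inv` for the inverse in `Sp_{2n}`. DERIVED HERE. -/
theorem orlovTildeBlock_eq_symplecticInv (σ : R →+* R) (a b c d : Matrix n n R) :
    fromBlocks (d.map σ)ᵀ (-(b.map σ)ᵀ) (-(c.map σ)ᵀ) (a.map σ)ᵀ =
      -Matrix.J n R * ((fromBlocks a b c d).map σ)ᵀ * Matrix.J n R := by
  rw [Matrix.J, fromBlocks_neg, fromBlocks_map, fromBlocks_transpose]
  simp [fromBlocks_multiply]

omit [Fintype n] [DecidableEq n] in
/-- Entrywise `RingHom.id` does nothing. [folklore] -/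
private theorem map_ringHom_id {m : Type*} (M : Matrix m m R) : M.map (RingHom.id R) = M := by
  rw [RingHom.coe_id, Matrix.map_id]

/-- **Example 4.15 in kernel form.** For `σ = id` (`End(E) = ℤ`, Rosati involution = transpose) Orlov's
isometry condition `f̃ · f = 1`, `f̃ = (dᵀ −bᵀ; −cᵀ aᵀ)` ([cite: Orlov2002DerivedAbelian, Def 2.17]),
holds iff `f = (a b; c d)` lies in Mathlib's `Matrix.symplecticGroup n R` — "Then the group `U(A × Â)` is
isomorphic to `Sp_{2n}(ℤ)`" [cite: Orlov2002DerivedAbelian, Ex 4.15] (`A = Eⁿ`, `E` without complex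
multiplication; `k = k̄`, `char k = 0` in §4). DERIVED HERE in the block model; the modelling step
`End(Eⁿ × Êⁿ) = M₂(Mₙ(ℤ))`, hat = transpose, is assumed, not proved. -/
theorem orlovIsometricBlock_id_iff_mem_symplecticGroup (a b c d : Matrix n n R) :
    fromBlocks dᵀ (-bᵀ) (-cᵀ) aᵀ * fromBlocks a b c d = 1 ↔
      fromBlocks a b c d ∈ Matrix.symplecticGroup n R := by
  have key : fromBlocks dᵀ (-bᵀ) (-cᵀ) aᵀ =
      -Matrix.J n R * (fromBlocks a b c d)ᵀ * Matrix.J n R := by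
    simpa only [map_ringHom_id] using orlovTildeBlock_eq_symplecticInv (RingHom.id R) a b c d
  set F := fromBlocks a b c d
  rw [key]
  constructor
  · intro h
    rw [SymplecticGroup.mem_iff']
    calc Fᵀ * Matrix.J n R * F = -(Matrix.J n R * Matrix.J n R) * (Fᵀ * Matrix.J n R * F) := by
          rw [Matrix.J_squared, neg_neg, Matrix.one_mul]
      _ = Matrix.J n R * (-Matrix.J n R * Fᵀ * Matrix.J n R * F) := by
          simp only [Matrix.neg_mul, Matrix.mul_neg, Matrix.mul_assoc]
      _ = Matrix.J n R := by rw [h, Matrix.mul_one]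
  · intro hF
    simpa only [Matrix.neg_mul] using SymplecticGroup.inv_left_mul_aux hF

/-- The same for an arbitrary `σ` on `σ`-FIXED matrices (`End(E) ⊇ ℤ`; e.g. integer matrices at a CM point):
`f̃ f = 1 ⟺ f ∈ Sp_{2n}(R)`, i.e. `Sp_{2n}(ℤ) ⊂ U(Eⁿ × Êⁿ)` also in the CM case. DERIVED HERE. -/
theorem orlovIsometricBlock_iff_mem_symplecticGroup_of_map_eq (σ : R →+* R) (a b c d : Matrix n n R)
    (hfix : (fromBlocks a b c d).map σ = fromBlocks a b c d) :
    fromBlocks (d.map σ)ᵀ (-(b.map σ)ᵀ) (-(c.map σ)ᵀ) (a.map σ)ᵀ * fromBlocks a b c d = 1 ↔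
      fromBlocks a b c d ∈ Matrix.symplecticGroup n R := by
  rw [fromBlocks_map, fromBlocks_inj] at hfix
  obtain ⟨ha, hb, hc, hd⟩ := hfix
  rw [ha, hb, hc, hd]
  exact orlovIsometricBlock_id_iff_mem_symplecticGroup a b c d

omit [Fintype n] in
/-- Entrywise ring endomorphisms fix the identity matrix. [folklore] -/
private theorem map_one_block (σ : R →+* R) : (1 : Matrix n n R).map σ = 1 :=
  Matrix.map_one _ (map_zero σ) (map_one σ)

omit [Fintype n] [DecidableEq n] in
/-- Entrywise ring endomorphisms fix the zero matrix. [folklore] -/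
private theorem map_zero_block' (σ : R →+* R) : (0 : Matrix n n R).map σ = 0 :=
  Matrix.map_zero _ (map_zero σ)

/-- **Translations.** `T_S = (1 S; 0 1)` satisfies `T_S† J T_S = J` iff `S† = S` (`S† := σ(S)ᵀ`): for
`σ = id` iff `S` is symmetric (the `⊗L_S`, `S ∈ NS(Eⁿ) ≅ Symₙ(ℤ)`, of the cell's S4 corner 2), for a CM
order iff `S` is `σ`-hermitian. DERIVED HERE in the block model of [cite: Orlov2002DerivedAbelian, Def 2.17];
not a printed statement. -/
theorem orlovIsometricBlock_transvection_iff (σ : R →+* R) (s : Matrix n n R) :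
    ((fromBlocks 1 s 0 1).map σ)ᵀ * (fromBlocks 0 1 (-1) 0 : Matrix (n ⊕ n) (n ⊕ n) R) * fromBlocks 1 s 0 1 =
        (fromBlocks 0 1 (-1) 0 : Matrix (n ⊕ n) (n ⊕ n) R) ↔ (s.map σ)ᵀ = s := by
  rw [fromBlocks_map, fromBlocks_transpose, map_one_block, map_zero_block']
  simp only [fromBlocks_multiply, transpose_one, transpose_zero, Matrix.neg_mul, Matrix.one_mul,
    Matrix.mul_one, Matrix.zero_mul, Matrix.mul_zero, add_zero, zero_add, fromBlocks_inj, true_and,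
    neg_add_eq_zero]
  exact eq_comm

/-- **`J ∈ U`.** `J = (0 1; −1 0)` satisfies `J† J J = J` for every `σ` (its entries are `0, ±1`).
DERIVED HERE. -/
theorem orlovIsometricBlock_blockJ (σ : R →+* R) :
    ((fromBlocks 0 1 (-1) 0 : Matrix (n ⊕ n) (n ⊕ n) R).map σ)ᵀ * (fromBlocks 0 1 (-1) 0 : Matrix (n ⊕ n) (n ⊕ n) R) *
        (fromBlocks 0 1 (-1) 0 : Matrix (n ⊕ n) (n ⊕ n) R) = (fromBlocks 0 1 (-1) 0 : Matrix (n ⊕ n) (n ⊕ n) R) := by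
  have hfix : (fromBlocks 0 1 (-1) 0 : Matrix (n ⊕ n) (n ⊕ n) R).map σ = fromBlocks 0 1 (-1) 0 := by
    rw [fromBlocks_map, map_zero_block', Matrix.map_neg _ (map_neg σ), map_one_block]
  rw [hfix, fromBlocks_transpose]
  simp [fromBlocks_multiply]

/-- **Scaling the Gram matrix by a unit.** `f† J f = J ⟺ f† (z • J) f = z • J` for a unit `z ∈ R`. Over
`ℤ[i]` with `z = i` the right-hand side is the unitarity of `f` for the HERMITIAN matrix `iJ`
(`gaussInt_omega_smul_blockJ_conjTranspose`): in the block model `U(E_iⁿ × Ê_iⁿ)` is the unitary group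
of the hermitian `ℤ[i]`-lattice `(ℤ[i]^{2n}, iJ)` (signature `(n, n)`) — the cell's S4 name «`U(6,6)(ℤ[i])`»
for `n = 6` (`s4push/search-2/g6/SHADOW-TEST-search-2-g6.md` (u1)). DERIVED HERE. -/
theorem orlovIsometricBlock_iff_smul_unit (σ : R →+* R) {z : R} (hz : IsUnit z)
    (F : Matrix (n ⊕ n) (n ⊕ n) R) :
    (F.map σ)ᵀ * (fromBlocks 0 1 (-1) 0 : Matrix (n ⊕ n) (n ⊕ n) R) * F =
        (fromBlocks 0 1 (-1) 0 : Matrix (n ⊕ n) (n ⊕ n) R) ↔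
      (F.map σ)ᵀ * (z • (fromBlocks 0 1 (-1) 0 : Matrix (n ⊕ n) (n ⊕ n) R)) * F =
        z • (fromBlocks 0 1 (-1) 0 : Matrix (n ⊕ n) (n ⊕ n) R) := by
  rw [Matrix.mul_smul, Matrix.smul_mul, hz.smul_left_cancel]

end Symplectic

section QuadraticOrder

open QuadraticAlgebra

variable {n : Type*} [Fintype n] [DecidableEq n]

/-- **Witness for every quadratic order, every `n ≥ 2`.** In `ℤ[ω] = QuadraticAlgebra ℤ a b` with
`σ = star` and indices `i ≠ j`: `F = diag(u, v)`, `u = 1 + ω E_{ij}`, `v = 1 − σ(ω) E_{ji}`, satisfies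
`F† J F = J` (because `u† v = 1 = v† u`, as `E_{ji} E_{ji} = 0 = E_{ij} E_{ij}`), i.e. `F ∈ U(Eⁿ × Êⁿ)` in
the block model when `End(E) = ℤ[ω]` is a CM order. DERIVED HERE (a computation). -/
theorem quadraticOrder_blockDiag_isometric (a b : ℤ) {i j : n} (hij : i ≠ j) :
    ((fromBlocks (1 + Matrix.single i j (ω : QuadraticAlgebra ℤ a b)) 0 0
            (1 - Matrix.single j i (star (ω : QuadraticAlgebra ℤ a b)))).map
          (starRingEnd (QuadraticAlgebra ℤ a b)))ᵀ *
        (fromBlocks 0 1 (-1) 0 : Matrix (n ⊕ n) (n ⊕ n) (QuadraticAlgebra ℤ a b)) *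
        fromBlocks (1 + Matrix.single i j (ω : QuadraticAlgebra ℤ a b)) 0 0
          (1 - Matrix.single j i (star (ω : QuadraticAlgebra ℤ a b))) =
      (fromBlocks 0 1 (-1) 0 : Matrix (n ⊕ n) (n ⊕ n) (QuadraticAlgebra ℤ a b)) := by
  set u : Matrix n n (QuadraticAlgebra ℤ a b) := 1 + Matrix.single i j ω with hu
  set v : Matrix n n (QuadraticAlgebra ℤ a b) := 1 - Matrix.single j i (star ω) with hv
  have hu' : (u.map (starRingEnd (QuadraticAlgebra ℤ a b)))ᵀ = 1 + Matrix.single j i (star ω) := by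
    rw [hu, Matrix.map_add _ (map_add _), Matrix.map_one _ (map_zero _) (map_one _), Matrix.map_single, transpose_add,
      transpose_one, transpose_single, starRingEnd_apply]
  have hv' : (v.map (starRingEnd (QuadraticAlgebra ℤ a b)))ᵀ = 1 - Matrix.single i j ω := by
    rw [hv, Matrix.map_sub _ (map_sub _), Matrix.map_one _ (map_zero _) (map_one _), Matrix.map_single, transpose_sub,
      transpose_one, transpose_single, starRingEnd_apply, star_star]
  have h1 : (u.map (starRingEnd (QuadraticAlgebra ℤ a b)))ᵀ * v = 1 := by
    rw [hu', hv, Matrix.add_mul, Matrix.one_mul, Matrix.mul_sub, Matrix.mul_one,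
      Matrix.single_mul_single_of_ne (h := hij), sub_zero, sub_add_cancel]
  have h2 : (v.map (starRingEnd (QuadraticAlgebra ℤ a b)))ᵀ * u = 1 := by
    rw [hv', hu, Matrix.sub_mul, Matrix.one_mul, Matrix.mul_add, Matrix.mul_one,
      Matrix.single_mul_single_of_ne (h := hij.symm), add_zero, add_sub_cancel_right]
  have h0 : (0 : Matrix n n (QuadraticAlgebra ℤ a b)).map (starRingEnd (QuadraticAlgebra ℤ a b)) = 0 :=
    Matrix.map_zero _ (map_zero _)
  rw [fromBlocks_map, fromBlocks_transpose, h0, transpose_zero]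
  simp only [fromBlocks_multiply, Matrix.zero_mul, Matrix.mul_zero, add_zero, zero_add, Matrix.mul_one,
    Matrix.mul_neg, Matrix.neg_mul, neg_zero, h1, h2]

omit [Fintype n] in
/-- … and that `F` is NOT `ζ · H` for any `ζ ∈ ℤ[ω]` and any integer matrix `H`: its `(i,i)` entry is `1`
and its `(i,j)` entry is `ω`, whereas all entries of `ζ · H` lie in `ζ · ℤ`. With
`quadraticOrder_blockDiag_isometric`: for every CM order `End(E) = ℤ[ω]` and every `n ≥ 2`,
`U(Eⁿ × Êⁿ) ⊋ μ_K · Sp_{2n}(ℤ)` in the block model (indeed `U ⊄ ℤ[ω] · M_{2n}(ℤ)`). DERIVED HERE. -/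
theorem quadraticOrder_blockDiag_ne_smul_intCast (a b : ℤ) {i j : n} (hij : i ≠ j)
    (z : QuadraticAlgebra ℤ a b) (H : Matrix (n ⊕ n) (n ⊕ n) ℤ) :
    fromBlocks (1 + Matrix.single i j (ω : QuadraticAlgebra ℤ a b)) 0 0
        (1 - Matrix.single j i (star (ω : QuadraticAlgebra ℤ a b))) ≠
      z • H.map (Int.castRingHom (QuadraticAlgebra ℤ a b)) := by
  intro h
  have hii := congrFun (congrFun h (Sum.inl i)) (Sum.inl i)
  have hij' := congrFun (congrFun h (Sum.inl i)) (Sum.inl j)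
  simp only [fromBlocks_apply₁₁, Matrix.add_apply, Matrix.one_apply_eq, Matrix.one_apply_ne hij,
    Matrix.single_apply_same, Matrix.single_apply_of_col_ne i i hij.symm, add_zero, zero_add,
    Matrix.smul_apply, Matrix.map_apply, eq_intCast, smul_eq_mul, QuadraticAlgebra.ext_iff, re_one, im_one,
    re_mul, im_mul, re_intCast, im_intCast, omega_re, omega_im, mul_zero, add_zero, zero_add] at hii hij'
  -- hii : 1 = z.re * H_ii ∧ 0 = z.im * H_ii ;  hij' : 0 = z.re * H_ij ∧ 1 = z.im * H_ij
  obtain ⟨hr, hi⟩ := hii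
  obtain ⟨-, hj⟩ := hij'
  have hzi : z.im = 0 := by
    rcases mul_eq_zero.mp hi.symm with h0 | h0
    · exact h0
    · exfalso
      rw [h0, mul_zero] at hr
      exact one_ne_zero hr
  rw [hzi, zero_mul] at hj
  exact one_ne_zero hj

omit [Fintype n] in
/-- **`iJ` is hermitian over `ℤ[i]`**: `((i • J).map σ)ᵀ = i • J` for `σ` = complex conjugation
(`QuadraticAlgebra ℤ (-1) 0`, `i = ω`), since `σ(i) = −i` and `Jᵀ = −J`. With
`orlovIsometricBlock_iff_smul_unit` (`i` is a unit): `U(E_iⁿ × Ê_iⁿ) = {f : f† (iJ) f = iJ}`, the unitary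
group of a hermitian (not skew) form of signature `(n, n)`. DERIVED HERE (a computation). -/
theorem gaussInt_omega_smul_blockJ_conjTranspose :
    (((ω : QuadraticAlgebra ℤ (-1) 0) •
          (fromBlocks 0 1 (-1) 0 : Matrix (n ⊕ n) (n ⊕ n) (QuadraticAlgebra ℤ (-1) 0))).map
        (starRingEnd (QuadraticAlgebra ℤ (-1) 0)))ᵀ =
      (ω : QuadraticAlgebra ℤ (-1) 0) •
        (fromBlocks 0 1 (-1) 0 : Matrix (n ⊕ n) (n ⊕ n) (QuadraticAlgebra ℤ (-1) 0)) := by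
  ext (i | i) (j | j) <;> by_cases h : i = j <;>
    simp [starRingEnd_apply, h, eq_comm]

end QuadraticOrder

end Summit.Ventures.HSemireg
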